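import Summits.BirchSwinnertonDyer.BirchSwinnertonDyer.Theorems.ByReductionTypeAtTwoMultTransportKlein
import HarnessLib

/-!
# Route `AlignedTransportAtTwo`, crux C2 `MainConjectureOfRankZeroBSDAtTwo` (stmt-BirchSwinnertonDyer-22298),
# road (b″): PERFECT DESCENT at `2`, part I — `H¹(Q, V₄) = 0` for EVERY faithful action on the Klein four-group
# (crossed homomorphisms into `E[2]` vanishing on the kernel of the action are principal)

Cell `bsd-f1-sign2`, WIDTH-5 attach seat `bsd-line-att-p3` (gen 4) on line `birth` of crux C2
(`--supports` stmt-BirchSwinnertonDyer-22298; closes nothing). HONEST FRAMING: THEOREMS ONLY — no definition, no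
named fact, no instance, no `sorry`; BSD is NOT proved by any of this. This is the kernel form of §2 of the lead's
note `Cruxes/MainConjectureOfRankZeroBSDAtTwo/PERFECT-DESCENT.md` (att-p2 g4, 2026-08-28) and of item (α) of its
audit checklist: the one special fact at `p = 2` — the Klein four-group `E[2] ≅ 𝔽₂²` is a PROJECTIVE
`𝔽₂[S₃]`-module (the Steinberg module of `GL₂(𝔽₂) ≅ S₃`), so its first cohomology vanishes on EVERY subgroup of
`S₃`, including the order-`2` subgroups (decomposition groups at real and ramified places) where the odd-`p`
analogue (`𝔽_p²` under `GL₂(𝔽_p)`) fails. The sequel `…FineRoadPerfectDescent` turns this into the injectivity of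
`res : H¹(H, E[2]) → H¹(H ⊓ ker ρ̄_{E,2}, E[2])` for every `H ≤ Γ_K` in the tree's model.

## What is proved (pure algebra: a group `Q`, a `DistribMulAction` of `Q` on an additive group `M` with `#M = 4` and
`m + m = 0`; the tree's `MultTransportAtTwo.klein_cases` enumerates `M = {0, a, b, a + b}`)

* toolkit: `smul_eq_smul_of_generators` / `smul_eq_self_of_generators` (an action is determined on `a, b`),
  `smul_smul_eq_add_of_fpf` (`σ² m = m + σ m` for a fixed-point-free `σ`, i.e. `1 + σ + σ² = 0`:
  `add_smul_add_smul_smul_eq_zero_of_fpf`), **`fpf_smul_dichotomy`** (two fixed-point-free elements act identically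
  or as `σ, σ²` — `A₃ ⊴ S₃`), `crossedHom_eq_of_forall_smul_eq`, `crossedHom_inv`;
* **`klein_crossedHom_principal`**: every crossed homomorphism `ψ : Q → M` (`ψ (g h) = ψ g + g • ψ h`) vanishing on
  every element that acts trivially is PRINCIPAL, `ψ g = g • a - a`. Equivalently `H¹(Q̄, M) = 0` for the image
  `Q̄ ≤ Aut(M) ≅ S₃`. Proof by the two shapes of `Q̄`: (A) `Q̄ ∋` a fixed-point-free `σ` (a `3`-cycle): subtract the
  principal cocycle through `(σ - 1)⁻¹ ψ(σ)`; then `ψ` vanishes at every conjugate `g σ g⁻¹` (dichotomy) and the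
  identity `ψ(g σ g⁻¹) = ψ g - (g σ g⁻¹) • ψ g` forces `ψ g = 0`; (B) otherwise every non-trivial element acts as ONE
  transposition `t` (`t a₀ = a₀`, `t b = a₀ + b`; two distinct transpositions compose to a `3`-cycle), `ψ` is constant
  `= x ∈ M^t = {0, a₀} = (1 + t)M` on them (`M|_{⟨t⟩}` is `𝔽₂[C₂]`-free), and `x = t • b - b` or `0`.

References: J.-P. Serre, *Galois Cohomology*, I §5.1 (crossed homomorphisms); K. S. Brown, *Cohomology of Groups*,
VI.8 (projective modules are cohomologically trivial); the `2`-descent folklore `H¹(G, E[2]) = 0` for all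
`G ≤ GL₂(𝔽₂)`.
-/

set_option autoImplicit false
-- the Theorems namespace of this sub repeats the summit name by design (D-0017 nested layout)
set_option linter.dupNamespace false

namespace Summit.BirchSwinnertonDyer.BirchSwinnertonDyer.Theorems.AlignedTransportAtTwoFineRoad.PerfectDescent

open Summit.BirchSwinnertonDyer.BirchSwinnertonDyer.Theorems.MultTransportAtTwo

/-! ## §1 Crossed homomorphisms into a Klein four-group are principal (`H¹(Q, V₄) = 0` for `Q ≤ S₃`) -/

section KleinH1

variable {Q : Type*} [Group Q] {M : Type*} [AddCommGroup M] [DistribMulAction Q M]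

/-- In a group of exponent `2`, `-m = m`. [folklore] -/
theorem klein_neg_eq (h2 : ∀ m : M, m + m = 0) (m : M) : -m = m := by
  rw [neg_eq_iff_add_eq_zero, h2]

/-- Two elements of `Q` agreeing on the generators `a, b` of the Klein four-group `{0, a, b, a + b}` act
identically. [folklore] -/
theorem smul_eq_smul_of_generators (h4 : Nat.card M = 4) (h2 : ∀ m : M, m + m = 0) {a b : M} (ha : a ≠ 0)
    (hb : b ≠ 0) (hab : a ≠ b) {q r : Q} (hqa : q • a = r • a) (hqb : q • b = r • b) (m : M) :
    q • m = r • m := by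
  rcases klein_cases h4 h2 ha hb hab m with rfl | rfl | rfl | rfl
  · rw [smul_zero, smul_zero]
  · exact hqa
  · exact hqb
  · rw [smul_add, smul_add, hqa, hqb]

/-- An element of `Q` fixing the generators `a, b` of the Klein four-group acts trivially. [folklore] -/
theorem smul_eq_self_of_generators (h4 : Nat.card M = 4) (h2 : ∀ m : M, m + m = 0) {a b : M} (ha : a ≠ 0)
    (hb : b ≠ 0) (hab : a ≠ b) {q : Q} (hqa : q • a = a) (hqb : q • b = b) (m : M) : q • m = m := by
  rcases klein_cases h4 h2 ha hb hab m with rfl | rfl | rfl | rfl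
  · rw [smul_zero]
  · exact hqa
  · exact hqb
  · rw [smul_add, hqa, hqb]

/-- **The square of a fixed-point-free automorphism of the Klein four-group**: if `σ` fixes only `0`, then
`σ • (σ • m) = m + σ • m` for every `m` (the three non-zero elements are `m, σ m, σ² m = m + σ m`: `σ` is a
`3`-cycle on them). [folklore] -/
theorem smul_smul_eq_add_of_fpf (h4 : Nat.card M = 4) (h2 : ∀ m : M, m + m = 0) {σ : Q}
    (hσ : ∀ m : M, σ • m = m → m = 0) (m : M) : σ • (σ • m) = m + σ • m := by
  by_cases hm : m = 0
  · subst hm; rw [smul_zero, smul_zero, add_zero]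
  have hσm0 : σ • m ≠ 0 := fun h ↦ hm ((smul_eq_zero_iff_eq σ).mp h)
  have hσm : σ • m ≠ m := fun h ↦ hm (hσ m h)
  rcases klein_cases h4 h2 hm hσm0 (Ne.symm hσm) (σ • (σ • m)) with h | h | h | h
  · exact absurd ((smul_eq_zero_iff_eq σ).mp h) hσm0
  · -- `σ` swaps `m` and `σ m`, hence fixes `m + σ m ≠ 0`
    exfalso
    have hfix : σ • (m + σ • m) = m + σ • m := by rw [smul_add, h, add_comm]
    have h0 : m + σ • m = 0 := hσ _ hfix
    exact hσm (by rw [eq_neg_of_add_eq_zero_right h0, klein_neg_eq h2])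
  · exact absurd (hσ _ h) hσm0
  · exact h

/-- `1 + σ + σ² = 0` on the Klein four-group for a fixed-point-free `σ`. [folklore] -/
theorem add_smul_add_smul_smul_eq_zero_of_fpf (h4 : Nat.card M = 4) (h2 : ∀ m : M, m + m = 0) {σ : Q}
    (hσ : ∀ m : M, σ • m = m → m = 0) (m : M) : m + σ • m + σ • (σ • m) = 0 := by
  rw [smul_smul_eq_add_of_fpf h4 h2 hσ]
  exact h2 _

/-- A Klein four-group has a non-zero element. [folklore] -/
theorem klein_exists_ne_zero (h4 : Nat.card M = 4) : ∃ m : M, m ≠ 0 := by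
  by_contra! h
  haveI : Subsingleton M := ⟨fun a b ↦ by rw [h a, h b]⟩
  have h1 : Nat.card M = 1 := Nat.card_of_subsingleton (0 : M)
  omega

/-- **`A₃ ⊴ S₃` on the Klein four-group**: two fixed-point-free elements `σ, c` act either identically or as
`σ` and `σ²` (the fixed-point-free automorphisms of `V₄` are exactly the two `3`-cycles). [folklore] -/
theorem fpf_smul_dichotomy (h4 : Nat.card M = 4) (h2 : ∀ m : M, m + m = 0) {σ c : Q}
    (hσ : ∀ m : M, σ • m = m → m = 0) (hc : ∀ m : M, c • m = m → m = 0) :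
    (∀ m : M, c • m = σ • m) ∨ (∀ m : M, c • m = σ • (σ • m)) := by
  obtain ⟨m₀, hm₀⟩ := klein_exists_ne_zero h4
  have hσm0 : σ • m₀ ≠ 0 := fun h ↦ hm₀ ((smul_eq_zero_iff_eq σ).mp h)
  have hσm : σ • m₀ ≠ m₀ := fun h ↦ hm₀ (hσ m₀ h)
  rcases klein_cases h4 h2 hm₀ hσm0 (Ne.symm hσm) (c • m₀) with h | h | h | h
  · exact absurd ((smul_eq_zero_iff_eq c).mp h) hm₀
  · exact absurd (hc _ h) hm₀
  · -- `c m₀ = σ m₀`: then `c (σ m₀) = c (c m₀) = m₀ + c m₀ = m₀ + σ m₀ = σ (σ m₀)`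
    left
    have h' : c • (σ • m₀) = σ • (σ • m₀) :=
      calc c • (σ • m₀) = c • (c • m₀) := by rw [h]
        _ = m₀ + c • m₀ := smul_smul_eq_add_of_fpf h4 h2 hc m₀
        _ = m₀ + σ • m₀ := by rw [h]
        _ = σ • (σ • m₀) := (smul_smul_eq_add_of_fpf h4 h2 hσ m₀).symm
    exact smul_eq_smul_of_generators h4 h2 hm₀ hσm0 (Ne.symm hσm) h h'
  · -- `c m₀ = m₀ + σ m₀ = σ² m₀`: then `c = σ²`
    right
    have hc0 : c • m₀ = σ • (σ • m₀) := by rw [h, smul_smul_eq_add_of_fpf h4 h2 hσ]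
    have e1 : σ • m₀ = m₀ + c • m₀ := by rw [h, ← add_assoc, h2, zero_add]
    have lhs : c • (σ • m₀) = m₀ := by
      rw [e1, smul_add, smul_smul_eq_add_of_fpf h4 h2 hc, add_left_comm, h2, add_zero]
    have rhs : σ • (σ • (σ • m₀)) = m₀ := by
      rw [smul_smul_eq_add_of_fpf h4 h2 hσ, smul_smul_eq_add_of_fpf h4 h2 hσ, add_left_comm, h2, add_zero]
    have h' : c • (σ • m₀) = (σ * σ) • (σ • m₀) := by rw [mul_smul, lhs, rhs]
    intro m
    rw [← mul_smul]
    exact smul_eq_smul_of_generators h4 h2 hm₀ hσm0 (Ne.symm hσm) (by rw [mul_smul]; exact hc0) h' m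

/-- A crossed homomorphism vanishing on the kernel of the action takes the same value on elements acting
identically (`r = q (q⁻¹ r)` with `q⁻¹ r` acting trivially). [folklore] -/
theorem crossedHom_eq_of_forall_smul_eq {ψ : Q → M} (hψ : ∀ g h : Q, ψ (g * h) = ψ g + g • ψ h)
    (hker : ∀ g : Q, (∀ m : M, g • m = m) → ψ g = 0) {q r : Q} (h : ∀ m : M, q • m = r • m) :
    ψ q = ψ r := by
  have htriv : ∀ m : M, (r⁻¹ * q) • m = m := fun m ↦ by rw [mul_smul, h, inv_smul_smul]
  have e := hψ r (r⁻¹ * q)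
  rw [mul_inv_cancel_left, hker _ htriv, smul_zero, add_zero] at e
  exact e

/-- For a crossed homomorphism vanishing on the kernel of the action: `ψ g⁻¹ = -(g⁻¹ • ψ g)`. [folklore] -/
theorem crossedHom_inv {ψ : Q → M} (hψ : ∀ g h : Q, ψ (g * h) = ψ g + g • ψ h)
    (hker : ∀ g : Q, (∀ m : M, g • m = m) → ψ g = 0) (g : Q) : ψ g⁻¹ = -(g⁻¹ • ψ g) := by
  have h1 : ψ 1 = 0 := hker 1 fun m ↦ one_smul Q m
  have e := hψ g g⁻¹
  rw [mul_inv_cancel, h1] at e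
  have e' : g • ψ g⁻¹ = -ψ g := eq_neg_of_add_eq_zero_right e.symm
  have e'' := congrArg (fun m ↦ g⁻¹ • m) e'
  simp only [inv_smul_smul, smul_neg] at e''
  exact e''

/-- **`H¹(Q, V₄) = 0` for every faithful action on the Klein four-group** (the Steinberg module of
`GL₂(𝔽₂) ≅ S₃` is projective over `𝔽₂[H]` for every `H ≤ S₃`). Concretely: let a group `Q` act on an additive
group `M` with four elements and `m + m = 0`, and let `ψ : Q → M` be a crossed homomorphism
(`ψ (g h) = ψ g + g • ψ h`) vanishing on every element that acts trivially. Then `ψ` is principal: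
`ψ g = g • a - a` for some `a ∈ M`. (Case A: some `σ` acts without non-zero fixed point — subtract the principal
cocycle through `(σ - 1)⁻¹ ψ(σ)`, then `ψ` vanishes on every conjugate of `σ` by `fpf_smul_dichotomy` and the
identity `ψ(g σ g⁻¹) = ψ g - (g σ g⁻¹) • ψ g` forces `ψ g = 0`. Case B: all non-trivial elements act as one
transposition `t` fixing `a₀`, swapping `b ↔ a₀ + b`; then `ψ` is `0` or `a₀ = t • b - b` on them.)
[cite: SerreGaloisCohomology1997, I §5.1 (crossed homomorphisms, principal ones)] -/
theorem klein_crossedHom_principal (h4 : Nat.card M = 4) (h2 : ∀ m : M, m + m = 0) (ψ : Q → M)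
    (hψ : ∀ g h : Q, ψ (g * h) = ψ g + g • ψ h) (hker : ∀ g : Q, (∀ m : M, g • m = m) → ψ g = 0) :
    ∃ a : M, ∀ g : Q, ψ g = g • a - a := by
  haveI : Finite M := Nat.finite_of_card_ne_zero (by rw [h4]; norm_num)
  by_cases hA : ∃ σ : Q, ∀ m : M, σ • m = m → m = 0
  · -- Case A: a fixed-point-free element `σ`
    obtain ⟨σ, hσ⟩ := hA
    have hsurj : Function.Surjective fun m : M ↦ σ • m - m := by
      apply Finite.surjective_of_injective
      intro m m' hmm'
      have e : σ • (m - m') = m - m' := by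
        rw [smul_sub]
        exact sub_eq_sub_iff_sub_eq_sub.mp hmm'
      exact sub_eq_zero.mp (hσ _ e)
    obtain ⟨a, ha⟩ := hsurj (ψ σ)
    simp only at ha
    refine ⟨a, ?_⟩
    set ψ' : Q → M := fun g ↦ ψ g - (g • a - a) with hψ'def
    have hψ' : ∀ g h : Q, ψ' (g * h) = ψ' g + g • ψ' h := by
      intro g h
      simp only [hψ'def, hψ g h, mul_smul, smul_sub]
      abel
    have hker' : ∀ g : Q, (∀ m : M, g • m = m) → ψ' g = 0 := by
      intro g hg
      simp only [hψ'def, hker g hg, hg a, sub_self]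
    have hσ' : ψ' σ = 0 := by simp only [hψ'def, ← ha, sub_self]
    suffices h0 : ∀ g : Q, ψ' g = 0 by
      intro g
      have e := h0 g
      simp only [hψ'def] at e
      exact sub_eq_zero.mp e
    intro g
    -- `c := g σ g⁻¹` is fixed-point-free
    have hc : ∀ m : M, (g * σ * g⁻¹) • m = m → m = 0 := by
      intro m hm
      rw [mul_smul, mul_smul] at hm
      have e : σ • (g⁻¹ • m) = g⁻¹ • m := by
        have e' := congrArg (fun x ↦ g⁻¹ • x) hm
        simp only [inv_smul_smul] at e'
        exact e'
      exact (smul_eq_zero_iff_eq g⁻¹).mp (hσ _ e)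
    -- `ψ' (g σ g⁻¹) = 0`: `g σ g⁻¹` acts as `σ` or as `σ²`
    have hψ'c : ψ' (g * σ * g⁻¹) = 0 := by
      rcases fpf_smul_dichotomy h4 h2 hσ hc with h | h
      · rw [crossedHom_eq_of_forall_smul_eq hψ' hker' h, hσ']
      · have h' : ∀ m : M, (g * σ * g⁻¹) • m = (σ * σ) • m := fun m ↦ by rw [h m, mul_smul σ σ]
        rw [crossedHom_eq_of_forall_smul_eq hψ' hker' h', hψ' σ σ, hσ', smul_zero, add_zero]
    -- the identity `ψ' (g σ g⁻¹) = ψ' g - (g σ g⁻¹) • ψ' g`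
    have hid : ψ' (g * σ * g⁻¹) = ψ' g - (g * σ * g⁻¹) • ψ' g := by
      rw [hψ' (g * σ) g⁻¹, hψ' g σ, hσ', smul_zero, add_zero, crossedHom_inv hψ' hker' g, smul_neg,
        ← mul_smul, sub_eq_add_neg]
    rw [hψ'c] at hid
    exact hc _ (sub_eq_zero.mp hid.symm).symm
  · -- Case B: every element has a non-zero fixed point
    push Not at hA
    by_cases htriv : ∀ g : Q, ∀ m : M, g • m = m
    · exact ⟨0, fun g ↦ by rw [hker g (htriv g), smul_zero, sub_zero]⟩
    push Not at htriv
    obtain ⟨q₀, b, hb⟩ := htriv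
    obtain ⟨a₀, ha₀q, ha₀⟩ := hA q₀
    have hb0 : b ≠ 0 := fun h ↦ hb (by rw [h, smul_zero])
    have hba : a₀ ≠ b := fun h ↦ hb (by rw [← h, ha₀q])
    -- `q₀` fixes `a₀` and swaps `b ↔ a₀ + b`
    have hq₀b : q₀ • b = a₀ + b := by
      rcases klein_cases h4 h2 ha₀ hb0 hba (q₀ • b) with h | h | h | h
      · exact absurd ((smul_eq_zero_iff_eq q₀).mp h) hb0
      · rw [← ha₀q] at h
        exact absurd (smul_left_cancel q₀ h) hba.symm
      · exact absurd h hb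
      · exact h
    have hq₀ab : q₀ • (a₀ + b) = b := by rw [smul_add, ha₀q, hq₀b, ← add_assoc, h2, zero_add]
    -- every element acts trivially or as `q₀` (two distinct transpositions would compose to a `3`-cycle)
    have hC : ∀ q : Q, (∀ m : M, q • m = m) ∨ (∀ m : M, q • m = q₀ • m) := by
      intro q
      by_cases hq : ∀ m : M, q • m = m
      · exact Or.inl hq
      right
      obtain ⟨a₁, ha₁q, ha₁⟩ := hA q
      suffices hgen : q • a₀ = a₀ ∧ q • b = a₀ + b by
        intro m
        exact smul_eq_smul_of_generators h4 h2 ha₀ hb0 hba (by rw [hgen.1, ha₀q]) (by rw [hgen.2, hq₀b]) m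
      rcases klein_cases h4 h2 ha₀ hb0 hba a₁ with h | h | h | h
      · exact absurd h ha₁
      · -- `q` fixes `a₀`
        rw [h] at ha₁q
        refine ⟨ha₁q, ?_⟩
        rcases klein_cases h4 h2 ha₀ hb0 hba (q • b) with e | e | e | e
        · exact absurd ((smul_eq_zero_iff_eq q).mp e) hb0
        · rw [← ha₁q] at e
          exact absurd (smul_left_cancel q e) hba.symm
        · exact absurd (smul_eq_self_of_generators h4 h2 ha₀ hb0 hba ha₁q e) hq
        · exact e
      · -- `q` fixes `b`: then `q₀ q` is a `3`-cycle, contradiction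
        exfalso
        rw [h] at ha₁q
        have hqa : q • a₀ = a₀ + b := by
          rcases klein_cases h4 h2 ha₀ hb0 hba (q • a₀) with e | e | e | e
          · exact absurd ((smul_eq_zero_iff_eq q).mp e) ha₀
          · exact absurd (smul_eq_self_of_generators h4 h2 ha₀ hb0 hba e ha₁q) hq
          · rw [← ha₁q] at e
            exact absurd (smul_left_cancel q e) hba
          · exact e
        have hqab : q • (a₀ + b) = a₀ := by rw [smul_add, hqa, ha₁q, add_assoc, h2, add_zero]
        obtain ⟨m₁, hm₁q, hm₁⟩ := hA (q₀ * q)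
        rw [mul_smul] at hm₁q
        rcases klein_cases h4 h2 ha₀ hb0 hba m₁ with e | e | e | e
        · exact hm₁ e
        · rw [e, hqa, hq₀ab] at hm₁q
          exact hba hm₁q.symm
        · rw [e, ha₁q, hq₀b] at hm₁q
          exact ha₀ (by simpa using hm₁q)
        · rw [e, hqab, ha₀q] at hm₁q
          exact hb0 (by simpa using hm₁q.symm)
      · -- `q` fixes `a₀ + b`: then `q₀ q` is a `3`-cycle, contradiction
        exfalso
        rw [h] at ha₁q
        have hbab : b = a₀ + (a₀ + b) := by rw [← add_assoc, h2, zero_add]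
        have hqa : q • a₀ = b := by
          rcases klein_cases h4 h2 ha₀ hb0 hba (q • a₀) with e | e | e | e
          · exact absurd ((smul_eq_zero_iff_eq q).mp e) ha₀
          · exfalso
            apply hq
            have hqb : q • b = b := by
              conv_lhs => rw [hbab]
              rw [smul_add, e, ha₁q, ← hbab]
            exact smul_eq_self_of_generators h4 h2 ha₀ hb0 hba e hqb
          · exact e
          · rw [← ha₁q] at e
            have e' := smul_left_cancel q e
            exact absurd (by simpa using e'.symm) hb0
        have hqb : q • b = a₀ := by
          conv_lhs => rw [hbab]
          rw [smul_add, hqa, ha₁q, add_left_comm, h2, add_zero]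
        obtain ⟨m₁, hm₁q, hm₁⟩ := hA (q₀ * q)
        rw [mul_smul] at hm₁q
        rcases klein_cases h4 h2 ha₀ hb0 hba m₁ with e | e | e | e
        · exact hm₁ e
        · rw [e, hqa, hq₀b] at hm₁q
          exact hb0 (by simpa using hm₁q)
        · rw [e, hqb, ha₀q] at hm₁q
          exact hba hm₁q
        · rw [e, ha₁q, hq₀ab] at hm₁q
          exact ha₀ (by simpa using hm₁q.symm)
    -- the value `x = ψ q₀` is `q₀`-fixed (`q₀²` acts trivially), hence `0` or `a₀`
    have hψC : ∀ q : Q, (∀ m : M, q • m = q₀ • m) → ψ q = ψ q₀ := fun q hq ↦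
      crossedHom_eq_of_forall_smul_eq hψ hker hq
    have hq₀q₀ : ∀ m : M, (q₀ * q₀) • m = m :=
      smul_eq_self_of_generators h4 h2 ha₀ hb0 hba (by rw [mul_smul, ha₀q, ha₀q])
        (by rw [mul_smul, hq₀b, hq₀ab])
    have hx : q₀ • ψ q₀ = ψ q₀ := by
      have e := hψ q₀ q₀
      rw [hker _ hq₀q₀] at e
      rw [eq_neg_of_add_eq_zero_right e.symm, klein_neg_eq h2]
    have hx' : ψ q₀ = 0 ∨ ψ q₀ = a₀ := by
      rcases klein_cases h4 h2 ha₀ hb0 hba (ψ q₀) with e | e | e | e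
      · exact Or.inl e
      · exact Or.inr e
      · exfalso
        rw [e, hq₀b] at hx
        exact ha₀ (by simpa using hx)
      · exfalso
        rw [e, hq₀ab] at hx
        exact ha₀ (by simpa using hx.symm)
    rcases hx' with hx0 | hxa
    · refine ⟨0, fun g ↦ ?_⟩
      rw [smul_zero, sub_zero]
      rcases hC g with hg | hg
      · exact hker g hg
      · rw [hψC g hg, hx0]
    · refine ⟨b, fun g ↦ ?_⟩
      rcases hC g with hg | hg
      · rw [hker g hg, hg b, sub_self]
      · rw [hψC g hg, hxa, hg b, hq₀b, add_sub_cancel_right]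

end KleinH1

end Summit.BirchSwinnertonDyer.BirchSwinnertonDyer.Theorems.AlignedTransportAtTwoFineRoad.PerfectDescent
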